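import Summits.QuantumFields.BalabanUV.Beta.GAN24.CombBorderTransportPush
import Summits.QuantumFields.BalabanUV.Beta.GAN24.CombBornBorderLetters
import Summits.QuantumFields.BalabanUV.Beta.GAN24.BornBorderContactNest
import Summits.QuantumFields.BalabanUV.Beta.GAN24.CombContactKernelCells
import Summits.QuantumFields.BalabanUV.Beta.GAN24.CombContactGaugeStaircase
import Summits.QuantumFields.BalabanUV.Beta.GAN24.ContactAssembly

/-!
# `BalabanUV.Beta.GAN24.CombBornBorderContactNest` — row G-an2-4 ∕ (CONV-C), TRANSFER-III, the (III′) S-slot (b), born-V sector: **THE (III′) V CONTACT TERM HAS NO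
# `𝒯 − 1` DEFECT** — the birth-level transport `𝒯 = Ψ̂ᵀ ∘ slotPsiS ∘ Ψ̂` of the border source is ABSORBED into CONJUGATED one-step legs (the border companion of road-P2
# M.47 `CombTransportPush`), the dressed lineage nests into the FULL conjugated chain `T″_i = legChain (j ↦ legComp ψ♭ R_j) i (m+1)` from the birth level, the multiplier
# legs see no gauge, and `D_{i,k} − U_{i,k}` (the body of road-P2 M.104's `hCv` binder: dressed (III′) lineage minus RAW undressed lineage) is leaf-03 g55's (E)
# `BornBorderContactNest.contact_v_eq_of_succ ∕ _of_top` shape VERBATIM with `T_i ↦ T″_i` and `vhSAt ρ ↦ tabs.V` (an1's RAW sym border table `symVhSAt ρ_c` at the record)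
# (OWNER `b2b-balaban-gan24-p1` gen 55; the design line asked for by leaf-01 g89's `S-SLOT-LETTERS-SIZING-g89.md` §3∕§4(iv) and road-P2's `S-CAMPAIGN-SIZING-g56` v0.5 §2(b) ∕ v0.6)

NOT IN PRINT — OUR BOOKKEEPING ([folklore] kernel bookkeeping BY NAME, generic `d` in §1–§2, `d = 3` in §3; 0 `def`, 0 cited fact, 0 `def … : Prop`, 0 sorry).  Over: the same seat's
`CombBorderTransportPush` (M.47's border companion), road-P2 M.51 `CombBornSector` (`combUnitStepMap`, `legDecay_combLeg`), M.56 `CombBornBorderLineage`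
(`combUnitStepMap_v_eq_two_push₃`), M.61 `CombBornBorderLetters` (`dressed_v_succ`), M.59 `CombContactKernelCells` (`combLegChain_sub_respStep`: `T″ − B = dz λ′`); leaf-01's
`Push3 ∕ Push3Nest` (`push₃_inl_inl`, `push₃_push₃`, linearity), `BornBorderLetters` (`push₃_respStep_self`, the Kronecker collapses), `Push4Iter.legDecay_legChain`; leaf-03 g55's
(E) `BornBorderContactNest` (`legDecay_neg`, `exists_legDecay_respStep_multi`), `LegCompAssoc.legChain_succ_left`, `MultiplierLegWard.legComp_colM∕rowMM_KStepUnit_eq_of_sub_eq_dz`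
(an1's multiplier-column Ward laws); leaf-01 g89's `CombContactGaugeStaircase.abs_combGauge_le` with the letters of leaf-01's (E) `ContactAssembly.exists_common_letters`; d1-leaf-03's
`SymCorrectorKernel.psiKS_*` ∕ `SymCorrectorFace.slotPsiS_apply_kernel`; leaf-12's `RespStepSemigroup` (`respStep_self`, `legComp_respStep`, `legComp_neg_left∕right`).
HONEST FRAMING (cell contract, verbatim): «discharging `BetaPertH` makes Bałaban's UV stability UNCONDITIONAL — a real constructive-QFT result; it is NOT the continuum limit
and NOT the Clay problem.»  HONEST DEPENDENCY (verbatim): «continuum YM on T⁴ ⇐ BetaPertH ∧ nine spine estimates (0/9 proved); BetaPertH ⇐ (D1) ∧ (D4) ∧ CAP+tail; G-an2-4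
gates asym, D1 and NE2/3/4.»  IDENTITIES ONLY: discharges NO letter of M.104 ∕ of the OWNER's END `CombChargeRowsOfBornContactLetters` (`hCv` stays a HYPOTHESIS until the (III′)
twins of leaf-03's (C2) `BornBorderContactLineage` ∕ (D) `BornBorderContactBound` are typed at `λ′` on an1's sym border table — their table side is leaf-02 g47's
`SymBorderGaugeLegContact`); NO estimate, NO value ∕ rate of Bałaban's tables; NEVER «G-an2-4 closed» as (CONV-C); NOT D1, NOT BetaPertH, NOT continuum, NOT Clay.

## What is proved (`Ψ̂ = psiKS r n`, `ψ♭ α x κ u := Ψ̂ u x (inl κ) (inl α)` written inline; at the comb data `r = ctrOff (d+1) Lc`, `n = Lc`, `ρ_c = ctr (d+1) Lc`)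
* (M.47's border companion `CombBorderTransportPush`, same seat: the mixed channels of `𝒯 V` are identity-leg pushes through `ψ♭` of the raw channels; the (III′)
  one-step image of the V-source reads the RAW table through the conjugated one-step legs `ψ♭R_i := legComp ψ♭ (respStepBmSeq ρ_c Lc i)` — `combUnitStepMap_v_eq_two_push₃_legComp`.)
* §1 **`push₃_combLegChain_combUnitStepMap_v`**: the dressed lineage nests — `push₃ T″ T″ T″ X_i = c₃ • (−(push₃ (−T″_i) (legComp (colM K̃_i Lc) T″) T″_i S + push₃ (legComp (rowMM K̃_i Lc) T″) T″_i T″_i S′))`,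
  `T″ = legChain (j ↦ legComp ψ♭ R_j) (i+1) m` (above the birth level), `T″_i = legChain (j ↦ legComp ψ♭ R_j) i (m+1)` (FROM the birth level: `legComp (ψ♭R_i) T″ = T″_i`).
* §2 `push₃_respStep_undressed_v`: the undressed lineage nests (leaf-03's (E) lemma with `vhSAt ρ ↦ tabs.V`; the table enters through `tabs.hV` only).
* §3 (`d = 3`, `2 ≤ Lc`) `legComp_colM∕rowMM_combLegChain_eq_respStep_three` (the conjugated outer chain and the undressed response AGREE on the multiplier legs);
  **`combContact_v_eq_of_succ`** (`k = i+(m+1)+1`): `D_{i,k} − U_{i,k} = −(c₃^{m+2} • ((push₃ (−T″_i) M_i T″_i S − push₃ (−B_i) M_i B_i S) + (push₃ M′_i T″_i T″_i S′ − push₃ M′_i B_i B_i S′)))`,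
  `B_i = respStep (Lc^i) (Lc^k)`, COMMON multiplier legs `M_i = legComp (colM K̃_i Lc) B′`, `M′_i = legComp (rowMM K̃_i Lc) B′`, `B′ = respStep (Lc^(i+1)) (Lc^k)`, the LEFT side
  LITERALLY the body of M.104's `hCv` binder; **`combContact_v_eq_of_top`** (`k = i+1`): the one-step telescope, same shapes at `n = 0`.
CONSEQUENCE (located, zero weight): `hCv ∕ hPcV` of M.104 are BY-NAME re-runs of leaf-03's (C2) `BornBorderContactLineage.abs_weight_mul_contact_v_le_three` ∕ (D)
`BornBorderContactBound.exists_hCgV_three` (and of the `BornBorderContactPair*` chain) with `T_i ↦ T″_i`, `λ ↦ λ′` (leaf-01 g89's `CombContactGaugeStaircase*`), tent ∕ bracket letters of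
the multiplier legs unchanged (`BornBorderContactBound` §1 is table-free), and the TABLE side `vhSAt ρ ↦ symVhSAt ρ_c`: the sym twins of leaf-03's (B1)–(B3) `ContactBorderCellLetters ∕
ContactBorderEntryBound(Mf)` over leaf-02's `ContactBorderCommutator ∕ ContactBorderKernelCells`, whose one table-specific input — the (K-V1) gauge-leg law of the border table — is
ALREADY in the tree for an1's sym table (leaf-02 g47 `SymBorderGaugeLegContact.gaugeLeg_symVhSAt_inl_inr ∕ _inr_inl ∕ _tsum`, `tsum_dz_mul_symVhSAt`).  No design line is missing.
2026-08-28; no existing file touched.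
-/

noncomputable section

open Finset
open scoped BigOperators
open Literature.MathematicalPhysics.QuantumFieldTheory
open Literature.MathematicalPhysics.QuantumFieldTheory.Balaban1983to89
open Literature.MathematicalPhysics.QuantumFieldTheory.Balaban1983to89.Beta
open ExpKernelCalculus (MKer Decays comp)
open AffineAveraging (Site box toSite)
open AveragingContoursRooted (ctr ctrOff ctrOff_mem_box)
open OneStepResolventKernel (Fib LocStencil)
open StepJetData (locStencil_smul)
open Literature.MathematicalPhysics.QuantumFieldTheory.LatticeForm (quo)
open B4ContourShift (supNorm supNorm_nonneg)
open BalabanCompositeJets (respStep)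
open Summit.QuantumFields.BalabanUV.Beta.SymCorrectorFace (faceWtSum faceWtSum_nonneg)
open Summit.QuantumFields.BalabanUV.Beta.TameKernelCalculus (trK trK_apply)
open Summit.QuantumFields.BalabanUV.Beta.AxialDressingRooted (one_le_of_neZero)
open Summit.QuantumFields.BalabanUV.Beta.SymCorrectorKernel (psiKS psiKS_inl_inl psiKS_inl_inr psiKS_inr_inl psiKS_inr_inr)
open Summit.QuantumFields.BalabanUV.Beta.SymCorrectorFace (slotPsiS slotPsiS_apply_kernel)
open Summit.QuantumFields.BalabanUV.Beta.SymmetrisedStepJets (SymTables)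
open Summit.QuantumFields.BalabanUV.Beta.GAN24.CombesThomas (KStepUnit)
open Summit.QuantumFields.BalabanUV.Beta.GAN24.Push4 (legComp legComp_apply vertexW IsFF)
open Summit.QuantumFields.BalabanUV.Beta.GAN24.Push4Bounds (LegDecay)
open Summit.QuantumFields.BalabanUV.Beta.GAN24.Push4Iter (LegFam legChain legChain_zero)
open Summit.QuantumFields.BalabanUV.Beta.GAN24.Push3 (push₃ push₃_inl_inl push₃_inr_left push₃_inr_right push₃_smul push₃_neg push₃_add
  locStencil_push₃_mono)
open Summit.QuantumFields.BalabanUV.Beta.GAN24.Push3Nest (push₃_push₃ legDecay_mono)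
open Summit.QuantumFields.BalabanUV.Beta.GAN24.AffineUnroll (transport)
open Summit.QuantumFields.BalabanUV.Beta.GAN24.RespStepSemigroup (respStep_self legComp_respStep legComp_neg_left legComp_neg_right)
open Summit.QuantumFields.BalabanUV.Beta.GAN24.RespStepBm (respStepBm legDecay_respStepBm_of_decays legDecay_neg_respStepBm_of_decays)
open Summit.QuantumFields.BalabanUV.Beta.GAN24.RespStepBmDecompPsi (legDecay_respStep_of_decays decays_KStepUnit_levels)
open Summit.QuantumFields.BalabanUV.Beta.GAN24.RespStepBmDecompExact (respStepBmSeq respStepBmSeq_apply)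
open Summit.QuantumFields.BalabanUV.Beta.GAN24.SrecLinearPartEq (colM rowMM reslot reslot_inl_inl reslot_inr_left reslot_inr_right legDecay_colM
  legDecay_rowMM locStencil_reslot)
open Summit.QuantumFields.BalabanUV.Beta.GAN24.BornBorderLetters (push₃_respStep_self isFF_twoPush tsum_sum_mul_ite tsum_sum_ite_mul)
open Summit.QuantumFields.BalabanUV.Beta.GAN24.CombTransportPush (vertexW_psiKS_eq_slotPsiS legDecay_psiKS)
open Summit.QuantumFields.BalabanUV.Beta.GAN24.CombBornSector (combUnitStepMap legDecay_combLeg)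
open Summit.QuantumFields.BalabanUV.Beta.GAN24.CombBornBorderLineage (combUnitStepMap_v_eq_two_push₃ isFF_combUnitStepMap_v isLoc_combUnitStepMap_v)
open Summit.QuantumFields.BalabanUV.Beta.GAN24.CombBornBorderLetters (dressed_v_succ dressed_v_top)
open Summit.QuantumFields.BalabanUV.Beta.GAN24.Push4Iter (legDecay_legChain)
open Summit.QuantumFields.BalabanUV.Beta.GAN24.BornBorderContactNest (legDecay_neg exists_legDecay_respStep_multi)
open Summit.QuantumFields.BalabanUV.Beta.GAN24.MultiplierLegWard (legComp_colM_KStepUnit_eq_of_sub_eq_dz legComp_rowMM_KStepUnit_eq_of_sub_eq_dz)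
open Summit.QuantumFields.BalabanUV.Beta.GAN24.CombContactKernelCells (combLegChain_sub_respStep)
open Summit.QuantumFields.BalabanUV.Beta.GAN24.CombContactGaugeStaircase (abs_combGauge_le)
open Summit.QuantumFields.BalabanUV.Beta.GAN24.ContactAssembly (exists_common_letters)

open Summit.QuantumFields.BalabanUV.Beta.GAN24.CombBorderTransportPush (combUnitStepMap_v_eq_two_push₃_legComp)

namespace Summit.QuantumFields.BalabanUV.Beta.GAN24.CombBornBorderContactNest

variable {d : ℕ}

section Birth

variable {Lc : ℕ} [NeZero Lc] (tabs : SymTables d Lc) (hVff : ∀ κ u x y (α β : Fin (d + 1)), tabs.V κ u x y (Sum.inl α) (Sum.inl β) = 0)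
  (hVmm : ∀ κ u x y (μ ν : Fin (d + 1)), tabs.V κ u x y (Sum.inr μ) (Sum.inr ν) = 0) (cE cVH : ℝ)
include hVff hVmm

/-! ## §1 The dressed (III′) lineage nests into the FULLY conjugated chain from the birth level -/

/-- NOT IN PRINT; OUR BOOKKEEPING ([folklore]; generic `d`).  **THE DRESSED (III′) V LINEAGE NESTS INTO TWO THREE-SLOT PUSHES THROUGH THE FULL CONJUGATED CHAIN**: with
`T″ = legChain (j ↦ legComp ψ♭ R_j) (i+1) m` (the conjugated chain ABOVE the birth level) and `T″_i = legChain (j ↦ legComp ψ♭ R_j) i (m+1)` (the conjugated chain FROM the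
birth level),
`push₃ T″ T″ T″ X_i = c₃ • (−(push₃ (−T″_i) (legComp (colM K̃_i Lc) T″) T″_i S + push₃ (legComp (rowMM K̃_i Lc) T″) T″_i T″_i S′))`, `X_i = combUnitStepMap Lc cE i (cVH • tabs.V)`,
`S ∕ S′` the RAW channels — `CombBorderTransportPush.combUnitStepMap_v_eq_two_push₃_legComp`, the push is linear (`push₃_smul ∕ _neg ∕ _add`), the pushes nest (`push₃_push₃`), and `legComp (ψ♭R_i) T″ = T″_i` (leaf-03's
`LegCompAssoc.legChain_succ_left` on M.51's localised conjugated legs).  The (III′) twin of leaf-03's `BornBorderContactNest.push₃_legChain_unitStepMap_v` with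
`respStepBmSeq ρ ↦ (j ↦ legComp ψ♭ (respStepBmSeq ρ_c Lc j))`, `vhSAt ρ ↦ tabs.V` — and NOTHING else. -/
theorem push₃_combLegChain_combUnitStepMap_v (i m : ℕ) (κ' : Fin (d + 1)) (u' : Fin (d + 1) → ℤ) :
    push₃ (legChain (fun j => legComp (fun α x κ u => psiKS (ctrOff (d + 1) Lc) Lc u x (Sum.inl κ) (Sum.inl α)) (respStepBmSeq (ctr (d + 1) Lc) Lc j)) (i + 1) m) (legChain (fun j => legComp (fun α x κ u => psiKS (ctrOff (d + 1) Lc) Lc u x (Sum.inl κ) (Sum.inl α)) (respStepBmSeq (ctr (d + 1) Lc) Lc j)) (i + 1) m) (legChain (fun j => legComp (fun α x κ u => psiKS (ctrOff (d + 1) Lc) Lc u x (Sum.inl κ) (Sum.inl α)) (respStepBmSeq (ctr (d + 1) Lc) Lc j)) (i + 1) m) (combUnitStepMap Lc cE i (fun κ u => cVH • tabs.V κ u)) κ' u'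
      = (cE * (Lc : ℝ) ^ (2 * (d + 1))) •
          -(push₃ (-(legChain (fun j => legComp (fun α x κ u => psiKS (ctrOff (d + 1) Lc) Lc u x (Sum.inl κ) (Sum.inl α)) (respStepBmSeq (ctr (d + 1) Lc) Lc j)) i (m + 1))) (legComp (colM (KStepUnit (d := d) Lc i) Lc) (legChain (fun j => legComp (fun α x κ u => psiKS (ctrOff (d + 1) Lc) Lc u x (Sum.inl κ) (Sum.inl α)) (respStepBmSeq (ctr (d + 1) Lc) Lc j)) (i + 1) m)) (legChain (fun j => legComp (fun α x κ u => psiKS (ctrOff (d + 1) Lc) Lc u x (Sum.inl κ) (Sum.inl α)) (respStepBmSeq (ctr (d + 1) Lc) Lc j)) i (m + 1)) (reslot Sum.inl Sum.inr fun κ u => cVH • tabs.V κ u) κ' u'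
            + push₃ (legComp (rowMM (KStepUnit (d := d) Lc i) Lc) (legChain (fun j => legComp (fun α x κ u => psiKS (ctrOff (d + 1) Lc) Lc u x (Sum.inl κ) (Sum.inl α)) (respStepBmSeq (ctr (d + 1) Lc) Lc j)) (i + 1) m)) (legChain (fun j => legComp (fun α x κ u => psiKS (ctrOff (d + 1) Lc) Lc u x (Sum.inl κ) (Sum.inl α)) (respStepBmSeq (ctr (d + 1) Lc) Lc j)) i (m + 1)) (legChain (fun j => legComp (fun α x κ u => psiKS (ctrOff (d + 1) Lc) Lc u x (Sum.inl κ) (Sum.inl α)) (respStepBmSeq (ctr (d + 1) Lc) Lc j)) i (m + 1)) (reslot Sum.inr Sum.inl fun κ u => cVH • tabs.V κ u) κ' u') := by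
  have hLc : 1 ≤ Lc := one_le_of_neZero Lc
  obtain ⟨CK, mK, hmK, hK⟩ := decays_KStepUnit_levels (d := d) (Lc := Lc) i
  have hl := fun j => legDecay_combLeg (d := d) (Lc := Lc) j
  -- the inner legs at the birth level, at one common rate
  obtain ⟨C₂, m₂', hm₂', h₂'⟩ := legDecay_combLeg (d := d) (Lc := Lc) i
  have hc₂' : LegDecay (colM (KStepUnit (d := d) Lc i) Lc) Lc CK mK := legDecay_colM hK
  have hr₂' : LegDecay (rowMM (KStepUnit (d := d) Lc i) Lc) Lc CK mK := legDecay_rowMM hK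
  have hm₂ : 0 < min m₂' mK := lt_min hm₂' hmK
  have hw₂ : LegDecay (legComp (fun α x κ u => psiKS (ctrOff (d + 1) Lc) Lc u x (Sum.inl κ) (Sum.inl α)) (respStepBmSeq (ctr (d + 1) Lc) Lc i)) Lc C₂ (min m₂' mK) := legDecay_mono h₂' (min_le_left _ _)
  have hl₂ : LegDecay (-(legComp (fun α x κ u => psiKS (ctrOff (d + 1) Lc) Lc u x (Sum.inl κ) (Sum.inl α)) (respStepBmSeq (ctr (d + 1) Lc) Lc i))) Lc C₂ (min m₂' mK) := legDecay_neg hw₂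
  have hc₂ : LegDecay (colM (KStepUnit (d := d) Lc i) Lc) Lc CK (min m₂' mK) := legDecay_mono hc₂' (min_le_right _ _)
  have hr₂ : LegDecay (rowMM (KStepUnit (d := d) Lc i) Lc) Lc CK (min m₂' mK) := legDecay_mono hr₂' (min_le_right _ _)
  -- the outer legs: the conjugated chain above the birth level, localised at blocking `Lc^(m+1)`
  obtain ⟨C₁, m₁, hm₁, hT⟩ := legDecay_legChain (N := Lc) hl (i + 1) m
  -- the two raw channels and the two inner pushes are local stencil families
  have hδ : (0 : ℝ) < min m₂' mK / 4 := by positivity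
  obtain ⟨CV, hV1⟩ := tabs.hV (min m₂' mK / 4) hδ.le
  have hV : LocStencil (fun κ u => cVH • tabs.V κ u) _ (min m₂' mK / 4) := locStencil_smul cVH hV1
  have hS := locStencil_reslot hV Sum.inl Sum.inr
  have hS' := locStencil_reslot hV Sum.inr Sum.inl
  have hP₁ := locStencil_push₃_mono hLc hl₂ hc₂ hw₂ hS hδ.le (by linarith)
  have hP₂ := locStencil_push₃_mono hLc hr₂ hw₂ hw₂ hS' hδ.le (by linarith)
  have e : legComp (legComp (fun α x κ u => psiKS (ctrOff (d + 1) Lc) Lc u x (Sum.inl κ) (Sum.inl α)) (respStepBmSeq (ctr (d + 1) Lc) Lc i)) (legChain (fun j => legComp (fun α x κ u => psiKS (ctrOff (d + 1) Lc) Lc u x (Sum.inl κ) (Sum.inl α)) (respStepBmSeq (ctr (d + 1) Lc) Lc j)) (i + 1) m) = (legChain (fun j => legComp (fun α x κ u => psiKS (ctrOff (d + 1) Lc) Lc u x (Sum.inl κ) (Sum.inl α)) (respStepBmSeq (ctr (d + 1) Lc) Lc j)) i (m + 1)) :=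
    (LegCompAssoc.legChain_succ_left hLc hl i m).symm
  rw [combUnitStepMap_v_eq_two_push₃_legComp tabs hVff hVmm cE cVH i, push₃_smul, push₃_neg, push₃_add hT hT hT hm₁ hP₁ hP₂ hδ hδ,
    push₃_push₃ hT hT hT hl₂ hc₂ hw₂ hm₁ hm₂ hS hδ, push₃_push₃ hT hT hT hr₂ hw₂ hw₂ hm₁ hm₂ hS' hδ, legComp_neg_left, e]


/-! ## §2 The undressed lineage nests (any sym record) -/

omit hVff hVmm in
/-- NOT IN PRINT; OUR BOOKKEEPING ([folklore]; generic `d`, any sym record).  **THE UNDRESSED V LINEAGE NESTS INTO TWO THREE-SLOT PUSHES**: with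
`B′ = respStep (Lc^(i+1)) (Lc^(i+(m+1)+1))`, `B_i = respStep (Lc^i) (Lc^(i+(m+1)+1))`, on the RAW channels `S ∕ S′` of `cVH • tabs.V`,
`push₃ B′ B′ B′ Y⁰_i = −(push₃ (−B_i) (legComp (colM K̃_i Lc) B′) B_i S + push₃ (legComp (rowMM K̃_i Lc) B′) B_i B_i S′)` — leaf-03's (E)
`BornBorderContactNest.push₃_respStep_undressed_v` VERBATIM with `vhSAt ρ ↦ tabs.V` (the table enters through its locality letter `tabs.hV` only). -/
theorem push₃_respStep_undressed_v (i m : ℕ) (κ' : Fin (d + 1)) (u' : Fin (d + 1) → ℤ) :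
    push₃ (respStep (d := d) (Lc ^ (i + 1)) (Lc ^ (i + (m + 1) + 1))) (respStep (d := d) (Lc ^ (i + 1)) (Lc ^ (i + (m + 1) + 1))) (respStep (d := d) (Lc ^ (i + 1)) (Lc ^ (i + (m + 1) + 1)))
        (fun κ u => -(push₃ (-(respStep (d := d) (Lc ^ i) (Lc ^ (i + 1)))) (colM (KStepUnit (d := d) Lc i) Lc) (respStep (d := d) (Lc ^ i) (Lc ^ (i + 1))) (reslot Sum.inl Sum.inr fun κ u => cVH • tabs.V κ u) κ u
          + push₃ (rowMM (KStepUnit (d := d) Lc i) Lc) (respStep (d := d) (Lc ^ i) (Lc ^ (i + 1))) (respStep (d := d) (Lc ^ i) (Lc ^ (i + 1))) (reslot Sum.inr Sum.inl fun κ u => cVH • tabs.V κ u) κ u)) κ' u'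
      = -(push₃ (-(respStep (d := d) (Lc ^ i) (Lc ^ (i + (m + 1) + 1)))) (legComp (colM (KStepUnit (d := d) Lc i) Lc) (respStep (d := d) (Lc ^ (i + 1)) (Lc ^ (i + (m + 1) + 1)))) (respStep (d := d) (Lc ^ i) (Lc ^ (i + (m + 1) + 1))) (reslot Sum.inl Sum.inr fun κ u => cVH • tabs.V κ u) κ' u'
          + push₃ (legComp (rowMM (KStepUnit (d := d) Lc i) Lc) (respStep (d := d) (Lc ^ (i + 1)) (Lc ^ (i + (m + 1) + 1)))) (respStep (d := d) (Lc ^ i) (Lc ^ (i + (m + 1) + 1))) (respStep (d := d) (Lc ^ i) (Lc ^ (i + (m + 1) + 1))) (reslot Sum.inr Sum.inl fun κ u => cVH • tabs.V κ u) κ' u') := by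
  have hLc : 1 ≤ Lc := one_le_of_neZero Lc
  obtain ⟨CK, mK, hmK, hK⟩ := decays_KStepUnit_levels (d := d) (Lc := Lc) i
  -- the inner legs, localised at blocking `Lc`
  have hw₂ : LegDecay (respStep (d := d) (Lc ^ i) (Lc ^ (i + 1))) Lc CK mK := legDecay_respStep_of_decays hK
  have hl₂ := legDecay_neg hw₂
  have hc₂ : LegDecay (colM (KStepUnit (d := d) Lc i) Lc) Lc CK mK := legDecay_colM hK
  have hm₂ : LegDecay (rowMM (KStepUnit (d := d) Lc i) Lc) Lc CK mK := legDecay_rowMM hK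
  -- the outer legs: the multi-step response above the birth level, localised at blocking `Lc^(m+1)`
  obtain ⟨C₁, m₁, hm₁, hB⟩ := exists_legDecay_respStep_multi (d := d) (Lc := Lc) (i + 1) m
  rw [show i + 1 + m + 1 = i + (m + 1) + 1 by omega] at hB
  have hδ : (0 : ℝ) < mK / 4 := by positivity
  obtain ⟨CV, hV1⟩ := tabs.hV (mK / 4) hδ.le
  have hV : LocStencil (fun κ u => cVH • tabs.V κ u) _ (mK / 4) := locStencil_smul cVH hV1
  have hS := locStencil_reslot hV Sum.inl Sum.inr
  have hS' := locStencil_reslot hV Sum.inr Sum.inl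
  have hP₁ := locStencil_push₃_mono hLc hl₂ hc₂ hw₂ hS hδ.le (by linarith)
  have hP₂ := locStencil_push₃_mono hLc hm₂ hw₂ hw₂ hS' hδ.le (by linarith)
  have hsg : legComp (respStep (d := d) (Lc ^ i) (Lc ^ (i + 1))) (respStep (d := d) (Lc ^ (i + 1)) (Lc ^ (i + (m + 1) + 1))) = (respStep (d := d) (Lc ^ i) (Lc ^ (i + (m + 1) + 1))) := legComp_respStep (L' := Lc ^ (m + 1)) (by ring)
  rw [push₃_neg, push₃_add hB hB hB hm₁ hP₁ hP₂ hδ hδ, push₃_push₃ hB hB hB hl₂ hc₂ hw₂ hm₁ hmK hS hδ,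
    push₃_push₃ hB hB hB hm₂ hw₂ hw₂ hm₁ hmK hS' hδ, legComp_neg_left, hsg]

end Birth

/-! ## §3 `d = 3`, `2 ≤ Lc`: the multiplier legs see no gauge; the contact term of one (III′) V lineage in the literal shape of M.104's `hCv` binder -/

section Three

variable {Lc : ℕ} [NeZero Lc]

/-- NOT IN PRINT; OUR BOOKKEEPING ([folklore]; `d = 3`, `2 ≤ Lc`, every lineage).  **THE CONJUGATED OUTER CHAIN AND THE UNDRESSED RESPONSE AGREE ON THE mm-COLUMN LEG** —
the multiplier-slot cell of the (III′) V contact VANISHES: `legComp (colM K̃_i Lc) T″ = legComp (colM K̃_i Lc) B′`, `T″ = legChain (j ↦ legComp ψ♭ R_j) (i+1) n`,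
`B′ = respStep (Lc^(i+1)) (Lc^(i+1+n+1))` — leaf-03's generic `MultiplierLegWard.legComp_colM_KStepUnit_eq_of_sub_eq_dz` (an1's multiplier-column Ward law) fed with road-P2 M.59
`combLegChain_sub_respStep` (`T″ − B′ = dz λ′`) and leaf-01 g89's plain envelope `CombContactGaugeStaircase.abs_combGauge_le` of `λ′` (letters from leaf-01's (E)
`ContactAssembly.exists_common_letters`).  The (III′) twin of leaf-03's `legComp_colM_legChain_eq_respStep_three`. -/
theorem legComp_colM_combLegChain_eq_respStep_three (hLc : 2 ≤ Lc) (i n : ℕ) :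
    legComp (colM (KStepUnit (d := 3) Lc i) Lc) (legChain (fun j => legComp (fun α x κ u => psiKS (ctrOff (3 + 1) Lc) Lc u x (Sum.inl κ) (Sum.inl α)) (respStepBmSeq (ctr (3 + 1) Lc) Lc j)) (i + 1) n)
      = legComp (colM (KStepUnit (d := 3) Lc i) Lc) (respStep (d := 3) (Lc ^ (i + 1)) (Lc ^ (i + 1 + n + 1))) := by
  obtain ⟨κ₀, C, KE, Φ₀, hκ, hC, -, -, hN1, -, -, -⟩ := exists_common_letters (Lc := Lc) hLc
  have hr : ctrOff (3 + 1) Lc ∈ box (3 + 1) Lc := ctrOff_mem_box (by omega)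
  have hF0 : 0 ≤ faceWtSum (ctrOff (3 + 1) Lc) Lc := faceWtSum_nonneg _ _
  have hA : 0 ≤ (2 * (8 * (Lc : ℝ) * C * ((Lc : ℝ) ^ (5 * (n + 1)))⁻¹
      + faceWtSum (ctrOff (3 + 1) Lc) Lc * ((1 + 8 * (Lc : ℝ) * (Real.exp κ₀ + 1)) * C * ((Lc : ℝ) ^ (5 * (n + 1)))⁻¹)) * (Lc : ℝ) ^ (n + 1)) := by
    positivity
  refine legComp_colM_KStepUnit_eq_of_sub_eq_dz i (Clam := (2 * (8 * (Lc : ℝ) * C * ((Lc : ℝ) ^ (5 * (n + 1)))⁻¹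
      + faceWtSum (ctrOff (3 + 1) Lc) Lc * ((1 + 8 * (Lc : ℝ) * (Real.exp κ₀ + 1)) * C * ((Lc : ℝ) ^ (5 * (n + 1)))⁻¹)) * (Lc : ℝ) ^ (n + 1)))
    (combLegChain_sub_respStep hr hr (i + 1) n) (fun μ z u => ?_)
  exact (abs_combGauge_le hκ.le hC hN1 hr hr le_rfl hLc (i + 1) n μ z u).trans
    (mul_le_of_le_one_right hA (Real.exp_le_one_iff.2 (neg_nonpos.2 (mul_nonneg hκ.le (supNorm_nonneg _)))))

/-- NOT IN PRINT; OUR BOOKKEEPING ([folklore]; `d = 3`, `2 ≤ Lc`).  **… AND ON THE mm-ROW LEG**: `legComp (rowMM K̃_i Lc) T″ = legComp (rowMM K̃_i Lc) B′`. -/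
theorem legComp_rowMM_combLegChain_eq_respStep_three (hLc : 2 ≤ Lc) (i n : ℕ) :
    legComp (rowMM (KStepUnit (d := 3) Lc i) Lc) (legChain (fun j => legComp (fun α x κ u => psiKS (ctrOff (3 + 1) Lc) Lc u x (Sum.inl κ) (Sum.inl α)) (respStepBmSeq (ctr (3 + 1) Lc) Lc j)) (i + 1) n)
      = legComp (rowMM (KStepUnit (d := 3) Lc i) Lc) (respStep (d := 3) (Lc ^ (i + 1)) (Lc ^ (i + 1 + n + 1))) := by
  obtain ⟨κ₀, C, KE, Φ₀, hκ, hC, -, -, hN1, -, -, -⟩ := exists_common_letters (Lc := Lc) hLc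
  have hr : ctrOff (3 + 1) Lc ∈ box (3 + 1) Lc := ctrOff_mem_box (by omega)
  have hF0 : 0 ≤ faceWtSum (ctrOff (3 + 1) Lc) Lc := faceWtSum_nonneg _ _
  have hA : 0 ≤ (2 * (8 * (Lc : ℝ) * C * ((Lc : ℝ) ^ (5 * (n + 1)))⁻¹
      + faceWtSum (ctrOff (3 + 1) Lc) Lc * ((1 + 8 * (Lc : ℝ) * (Real.exp κ₀ + 1)) * C * ((Lc : ℝ) ^ (5 * (n + 1)))⁻¹)) * (Lc : ℝ) ^ (n + 1)) := by
    positivity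
  refine legComp_rowMM_KStepUnit_eq_of_sub_eq_dz i (Clam := (2 * (8 * (Lc : ℝ) * C * ((Lc : ℝ) ^ (5 * (n + 1)))⁻¹
      + faceWtSum (ctrOff (3 + 1) Lc) Lc * ((1 + 8 * (Lc : ℝ) * (Real.exp κ₀ + 1)) * C * ((Lc : ℝ) ^ (5 * (n + 1)))⁻¹)) * (Lc : ℝ) ^ (n + 1)))
    (combLegChain_sub_respStep hr hr (i + 1) n) (fun μ z u => ?_)
  exact (abs_combGauge_le hκ.le hC hN1 hr hr le_rfl hLc (i + 1) n μ z u).trans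
    (mul_le_of_le_one_right hA (Real.exp_le_one_iff.2 (neg_nonpos.2 (mul_nonneg hκ.le (supNorm_nonneg _)))))

variable (tabs : SymTables 3 Lc) (hVff : ∀ κ u x y (α β : Fin (3 + 1)), tabs.V κ u x y (Sum.inl α) (Sum.inl β) = 0)
  (hVmm : ∀ κ u x y (μ ν : Fin (3 + 1)), tabs.V κ u x y (Sum.inr μ) (Sum.inr ν) = 0) (cE cVH : ℝ)
include hVff hVmm

/-- NOT IN PRINT; OUR BOOKKEEPING ([folklore]; `d = 3`, `2 ≤ Lc`, any sym record with an off-diagonal border table — in particular an1's `symVhSAt ρ_c`).  **THE CONTACT TERM OF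
ONE NESTED (III′) V LINEAGE** (`k = i+(m+1)+1`), THE LEFT SIDE IN THE LITERAL SHAPE OF road-P2 M.104's `hCv` binder (dressed lineage `transport combUnitStepMap (i+1) (k−1−i) X_i`
MINUS the RAW undressed lineage), THE RIGHT SIDE IN THE SHAPE OF leaf-03's (E) `BornBorderContactNest.contact_v_eq_of_succ` WITH `T_i ↦ T″_i := legChain (j ↦ legComp ψ♭ R_j) i (m+1)`
(the FULL conjugated chain from the birth level, whose difference with `B_i = respStep (Lc^i) (Lc^k)` is ONE pure-gauge family `dz λ′`, M.59) AND `vhSAt ρ ↦ tabs.V` (RAW):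
`D_{i,k} − U_{i,k} = −(c₃^{m+2} • ((push₃ (−T″_i) M_i T″_i S − push₃ (−B_i) M_i B_i S) + (push₃ M′_i T″_i T″_i S′ − push₃ M′_i B_i B_i S′)))`, with the COMMON multiplier legs
`M_i = legComp (colM K̃_i Lc) B′`, `M′_i = legComp (rowMM K̃_i Lc) B′` (`B′ = respStep (Lc^(i+1)) (Lc^k)`).  NO `𝒯 − 1` DEFECT TERM, NO transported table: the (III′) V contact
letter `hCv` is the (E) border-contact count re-run at the conjugated legs (gauge `λ′ = Ψ + PsiFace − bmGauge`, leaf-01 g89's staircase) on an1's RAW sym border table. -/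
theorem combContact_v_eq_of_succ (hLc : 2 ≤ Lc) {i m k : ℕ} (hk : k = i + (m + 1) + 1) (κ' : Fin (3 + 1)) (u' : Fin (3 + 1) → ℤ) :
    transport (combUnitStepMap Lc cE) (i + 1) (k - 1 - i) (combUnitStepMap Lc cE i (fun κ u => cVH • tabs.V κ u)) κ' u'
        - (cE * (Lc : ℝ) ^ (2 * (3 + 1))) ^ (k - i) •
            push₃ (respStep (d := 3) (Lc ^ (i + 1)) (Lc ^ k)) (respStep (d := 3) (Lc ^ (i + 1)) (Lc ^ k)) (respStep (d := 3) (Lc ^ (i + 1)) (Lc ^ k))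
              (fun κ u => -(push₃ (-(respStep (d := 3) (Lc ^ i) (Lc ^ (i + 1)))) (colM (KStepUnit (d := 3) Lc i) Lc)
                    (respStep (d := 3) (Lc ^ i) (Lc ^ (i + 1))) (reslot Sum.inl Sum.inr fun κ u => cVH • tabs.V κ u) κ u
                + push₃ (rowMM (KStepUnit (d := 3) Lc i) Lc) (respStep (d := 3) (Lc ^ i) (Lc ^ (i + 1)))
                    (respStep (d := 3) (Lc ^ i) (Lc ^ (i + 1))) (reslot Sum.inr Sum.inl fun κ u => cVH • tabs.V κ u) κ u)) κ' u'
      = -((cE * (Lc : ℝ) ^ (2 * (3 + 1))) ^ (m + 1 + 1) •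
          ((push₃ (-(legChain (fun j => legComp (fun α x κ u => psiKS (ctrOff (3 + 1) Lc) Lc u x (Sum.inl κ) (Sum.inl α)) (respStepBmSeq (ctr (3 + 1) Lc) Lc j)) i (m + 1))) (legComp (colM (KStepUnit (d := 3) Lc i) Lc) (respStep (d := 3) (Lc ^ (i + 1)) (Lc ^ (i + (m + 1) + 1)))) (legChain (fun j => legComp (fun α x κ u => psiKS (ctrOff (3 + 1) Lc) Lc u x (Sum.inl κ) (Sum.inl α)) (respStepBmSeq (ctr (3 + 1) Lc) Lc j)) i (m + 1)) (reslot Sum.inl Sum.inr fun κ u => cVH • tabs.V κ u) κ' u'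
              - push₃ (-(respStep (d := 3) (Lc ^ i) (Lc ^ (i + (m + 1) + 1)))) (legComp (colM (KStepUnit (d := 3) Lc i) Lc) (respStep (d := 3) (Lc ^ (i + 1)) (Lc ^ (i + (m + 1) + 1)))) (respStep (d := 3) (Lc ^ i) (Lc ^ (i + (m + 1) + 1))) (reslot Sum.inl Sum.inr fun κ u => cVH • tabs.V κ u) κ' u')
            + (push₃ (legComp (rowMM (KStepUnit (d := 3) Lc i) Lc) (respStep (d := 3) (Lc ^ (i + 1)) (Lc ^ (i + (m + 1) + 1)))) (legChain (fun j => legComp (fun α x κ u => psiKS (ctrOff (3 + 1) Lc) Lc u x (Sum.inl κ) (Sum.inl α)) (respStepBmSeq (ctr (3 + 1) Lc) Lc j)) i (m + 1)) (legChain (fun j => legComp (fun α x κ u => psiKS (ctrOff (3 + 1) Lc) Lc u x (Sum.inl κ) (Sum.inl α)) (respStepBmSeq (ctr (3 + 1) Lc) Lc j)) i (m + 1)) (reslot Sum.inr Sum.inl fun κ u => cVH • tabs.V κ u) κ' u'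
              - push₃ (legComp (rowMM (KStepUnit (d := 3) Lc i) Lc) (respStep (d := 3) (Lc ^ (i + 1)) (Lc ^ (i + (m + 1) + 1)))) (respStep (d := 3) (Lc ^ i) (Lc ^ (i + (m + 1) + 1))) (respStep (d := 3) (Lc ^ i) (Lc ^ (i + (m + 1) + 1))) (reslot Sum.inr Sum.inl fun κ u => cVH • tabs.V κ u) κ' u'))) := by
  subst hk
  rw [show i + (m + 1) + 1 - 1 - i = m + 1 by omega, show i + (m + 1) + 1 - i = m + 1 + 1 by omega, dressed_v_succ tabs hVff hVmm cE cVH i m]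
  dsimp only
  rw [push₃_combLegChain_combUnitStepMap_v tabs hVff hVmm cE cVH i m κ' u', push₃_respStep_undressed_v tabs cVH i m κ' u',
    legComp_colM_combLegChain_eq_respStep_three hLc i m, legComp_rowMM_combLegChain_eq_respStep_three hLc i m,
    show i + 1 + m + 1 = i + (m + 1) + 1 by omega, smul_smul, ← pow_succ]
  simp only [smul_neg, smul_add, smul_sub]
  abel

/-- NOT IN PRINT; OUR BOOKKEEPING ([folklore]; `d = 3`).  **THE CONTACT TERM OF THE TOP (III′) V LINEAGE** (`k = i+0+1`): the one-step telescope — the conjugated-leg image (`CombBorderTransportPush` §3) minus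
the RAW undressed image — LEFT side in the literal `hCv` shape, RIGHT side the nested shape at `n = 0` (`T″_i = legChain (j ↦ legComp ψ♭ R_j) i 0 = legComp ψ♭ R_i`,
`B_i = respStep (Lc^i) (Lc^(i+0+1))`, multiplier legs `colM ∕ rowMM K̃_i Lc` uncomposed).  The (III′) twin of leaf-03's `contact_v_eq_of_top`. -/
theorem combContact_v_eq_of_top {i k : ℕ} (hk : k = i + 0 + 1) (κ' : Fin (3 + 1)) (u' : Fin (3 + 1) → ℤ) :
    transport (combUnitStepMap Lc cE) (i + 1) (k - 1 - i) (combUnitStepMap Lc cE i (fun κ u => cVH • tabs.V κ u)) κ' u'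
        - (cE * (Lc : ℝ) ^ (2 * (3 + 1))) ^ (k - i) •
            push₃ (respStep (d := 3) (Lc ^ (i + 1)) (Lc ^ k)) (respStep (d := 3) (Lc ^ (i + 1)) (Lc ^ k)) (respStep (d := 3) (Lc ^ (i + 1)) (Lc ^ k))
              (fun κ u => -(push₃ (-(respStep (d := 3) (Lc ^ i) (Lc ^ (i + 1)))) (colM (KStepUnit (d := 3) Lc i) Lc)
                    (respStep (d := 3) (Lc ^ i) (Lc ^ (i + 1))) (reslot Sum.inl Sum.inr fun κ u => cVH • tabs.V κ u) κ u
                + push₃ (rowMM (KStepUnit (d := 3) Lc i) Lc) (respStep (d := 3) (Lc ^ i) (Lc ^ (i + 1)))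
                    (respStep (d := 3) (Lc ^ i) (Lc ^ (i + 1))) (reslot Sum.inr Sum.inl fun κ u => cVH • tabs.V κ u) κ u)) κ' u'
      = -((cE * (Lc : ℝ) ^ (2 * (3 + 1))) ^ (0 + 1) •
          ((push₃ (-(legChain (fun j => legComp (fun α x κ u => psiKS (ctrOff (3 + 1) Lc) Lc u x (Sum.inl κ) (Sum.inl α)) (respStepBmSeq (ctr (3 + 1) Lc) Lc j)) i 0)) (colM (KStepUnit (d := 3) Lc i) Lc) (legChain (fun j => legComp (fun α x κ u => psiKS (ctrOff (3 + 1) Lc) Lc u x (Sum.inl κ) (Sum.inl α)) (respStepBmSeq (ctr (3 + 1) Lc) Lc j)) i 0) (reslot Sum.inl Sum.inr fun κ u => cVH • tabs.V κ u) κ' u'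
              - push₃ (-(respStep (d := 3) (Lc ^ i) (Lc ^ (i + 0 + 1)))) (colM (KStepUnit (d := 3) Lc i) Lc)
                  (respStep (d := 3) (Lc ^ i) (Lc ^ (i + 0 + 1))) (reslot Sum.inl Sum.inr fun κ u => cVH • tabs.V κ u) κ' u')
            + (push₃ (rowMM (KStepUnit (d := 3) Lc i) Lc) (legChain (fun j => legComp (fun α x κ u => psiKS (ctrOff (3 + 1) Lc) Lc u x (Sum.inl κ) (Sum.inl α)) (respStepBmSeq (ctr (3 + 1) Lc) Lc j)) i 0) (legChain (fun j => legComp (fun α x κ u => psiKS (ctrOff (3 + 1) Lc) Lc u x (Sum.inl κ) (Sum.inl α)) (respStepBmSeq (ctr (3 + 1) Lc) Lc j)) i 0) (reslot Sum.inr Sum.inl fun κ u => cVH • tabs.V κ u) κ' u'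
              - push₃ (rowMM (KStepUnit (d := 3) Lc i) Lc) (respStep (d := 3) (Lc ^ i) (Lc ^ (i + 0 + 1)))
                  (respStep (d := 3) (Lc ^ i) (Lc ^ (i + 0 + 1))) (reslot Sum.inr Sum.inl fun κ u => cVH • tabs.V κ u) κ' u'))) := by
  subst hk
  simp only [Nat.add_zero, legChain_zero, zero_add, pow_one]
  rw [show i + 1 - 1 - i = 0 by omega, show i + 1 - i = 1 by omega, pow_one, AffineUnroll.transport_zero,
    push₃_respStep_self _ _ κ' u' (isFF_twoPush _ _ _ _ _ _ _ _ κ' u'), combUnitStepMap_v_eq_two_push₃_legComp tabs hVff hVmm cE cVH i]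
  simp only [smul_neg, smul_add, smul_sub]
  abel

end Three

end Summit.QuantumFields.BalabanUV.Beta.GAN24.CombBornBorderContactNest

end
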